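import Literature.Barriers.RiemannHypothesis.TuranPartialSumsShiftCover

/-!
# Sections of `ζ` beyond `σ = 1`: the vertical-shift construction — certified run, chunk 2

One compiled evaluation (`native_decide`) of
`Literature.Barriers.RiemannHypothesis.TuranShift.Cert.checkCells cover2`; see
`TuranPartialSumsShiftCheck.lean` for the checker, `TuranPartialSumsShiftCover.lean` for the cells
and `TuranPartialSumsShiftCheckSound.lean` (`criterion_of_checkCell`) for its meaning: for every
`N ≥ 360000` whose `log N` lies in one of these cells, the vertical-shift phases satisfy the
criterion `‖B‖ < R` (and its side condition), hence `ζ_N` vanishes somewhere in `σ > 1`.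
The only non-standard axiom of this file is the `native_decide` auxiliary axiom of
`cover2_ok` (trust in the Lean compiler), declared to the gate as `computational`.
-/

namespace Literature.Barriers.RiemannHypothesis.TuranShift.Cert

/-- **Chunk 2 of the cover is accepted by the checker.** [folklore] -/
theorem cover2_ok : checkCells cover2 = true := by
  native_decide

end Literature.Barriers.RiemannHypothesis.TuranShift.Cert
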